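import Literature.AlgebraicGeometry.Frobenioids.PadicKummerIsoTransport
import Literature.AnabelianGeometry.EtaleTheta.BiKummerThm44SubModelConnectedBaseInj
import Literature.AnabelianGeometry.EtaleTheta.BiKummerThm44SubGaloisDescent

/-!
# [EtTh] Theorem 4.4 (iii), sub-DAG row T44-L15b `Thm44Hyp.PreservesNHSaturatedBsFld` AT THE FAITHFUL
# [FrdII] Definition 2.2 (ii) READING: reduction to [FrdII] Theorem 2.4 (i) (proof-only)

S. Mochizuki, *The étale theta function and its Frobenioid-theoretic manifestations*, Publ. RIMS **45** (2009)
[MochizukiEtTh2009], §4, Thm 4.4 (iii) PDF p.94 (printed p.320), proof PDF p.95 ll.14–16 (printed p.321):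
«Then it follows from Proposition 4.2, (i) [and the "manifestly category-theoretic nature" of
"`(N, H^{bs-fld}_{⊙,i})`-saturation" — cf. [FrdII], Definition 2.2, (ii); [AbsAnab], Lemma 1.3.8] that "`A₁` is
`(N, H_{⊙,1}, f₁)`-saturated if and only if `A₂` is `(N, H_{⊙,2}, f₂)`-saturated"».  S. Mochizuki, *The geometry of
Frobenioids II*, Kyushu J. Math. **62** (2008) [MochizukiFrdII2008], Def 2.2 (ii) p.17 («(a) `A` is `μ_N`-saturated;
(b) `A_D` is Galois; (c) … `H ↠ H_A` induces isomorphisms … `H¹(H_A, μ_N(A)) ⥲ H¹(H, μ_N(A))`;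
`H¹(H_A, ℤ/Nℤ) ⥲ H¹(H, ℤ/Nℤ)` and a surjection … `H²(H_A, μ_N(A)) ↠ H²(H, μ_N(A))`») and Thm 2.4 (i) p.19 («`Ψ`
maps `(N, H₁)`-saturated objects to `(N, H₂)`-saturated objects»).

abc-iut cell, layer L2, plan/L2/SUBDAG-EtTh-Thm44.md (custodian lineage abc-iut-w5-d179) row **T44-L15b**,
«OPEN at every model instance … dischargeable only once `NH` is a concrete [FrdII] Def 2.2 (ii) predicate».
Seat abc-iut-w6-d047 (gen 2), GO abc-iut-L2-lead 08:39:46Z (R199) «T44-L15b AT THE FAITHFUL [FrdII] Def 2.2 (ii)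
READING … if the faithful reading needs an interface datum the tree lacks, deliver the reduction theorem + a
census line».  PROOF-ONLY companion (0 `def`s, no `Prop` fact, no instance); abc-iut-L1-t7's `PadicKummer.Def22Context`
/ `PadicKummer.IsNHSaturated`, abc-iut-L1-d4's `PadicKummer.Def22Context.Iso` / `Def22Context.Iso.isNHSaturated_iff`,
abc-iut-L2-t3's `Thm44Hyp` API, abc-iut-w5-d179's `thm44_mkOfConnectedTemperoid` (p431376) /
`thm44_mkOfConnectedTemperoid_of_hBinj` / `thm44_mkOfConnectedTemperoid_of_baseInj` (p436787) and abc-iut-L2-t4's `mkOfConnectedTemperoid` are CONSUMED BY NAME; nothing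
landed is edited or restated.  abc-iut-w4-d044's ROOTS READING (`BiKummerThm44SubNHSatRootsReading.lean`, p431503 /
p432854) is a different instantiation of the same free slot and is untouched.

## The faithful reading and what it reduces to

The `(N, H_⊙^{bs-fld})`-saturation predicate of Def 4.1 (iii)(a) («`A''` is `(N, H_⊙^{bs-fld})`-saturated
[cf. [FrdII], Definition 2.2, (ii)] as an object of `C^{bs-fld}`») is the FREE field
`BiKummerSetting.IsNHSaturatedBsFld` (TODO-merge(abc-iut-L1-t4)), the argument `NH` of `mkOfModelCanonical` /
`mkOfConnectedTemperoid`.  Its FAITHFUL reading is the tree's [FrdII] Def 2.2 (ii) predicate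
`PadicKummer.IsNHSaturated X N` over a Def 2.2 context `X : PadicKummer.Def22Context` ((a) `Kummer.IsMuSaturated`,
(b) `X.isGalois`, (c) `Kummer.IsCohSaturated` along the continuous surjection `X.qHA : H ↠ H_A`, continuous
cohomology).  A setting READS the slot faithfully when, at `H := H_⊙^{bs-fld}`, it factors through an assignment
of Def 2.2 contexts to the objects of `C` (hypotheses `hNH₁`, `hNH₂` below — the context assignment `ctx_i` is
exactly the interface datum the tree lacks, see the census).  AT THAT READING print's «manifestly
category-theoretic nature» is abc-iut-L1-d4's KERNEL THEOREM `Def22Context.Iso.isNHSaturated_iff` ([FrdII] Thm 2.4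
(i)), and T44-L15b REDUCES to its printed input: `Ψ` induces an isomorphism of the Def 2.2 contexts of `A''` and
`B'' ≅ Ψ(A'')` — [FrdI] Thm 3.4 (v) (`Aut_{C₁}(A'') ⥲ Aut_{C₂}(B'')`, `O^×` preserved), [SemiAnbd] Prop 3.2 / Thm A.4
(`Π^tp_{X₁} ⥲ Π^tp_{X₂}`, T44-L09) and [AbsAnab] Lem 1.3.8 (it lies over `G_{K₁} ⥲ G_{K₂}`, carrying
`H^{bs-fld}_{⊙,1}` onto `H^{bs-fld}_{⊙,2}`):
* `isNHSaturatedBsFld_iff_of_def22Iso` — one object pair, one context isomorphism;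
* `Thm44Hyp.preservesNHSaturatedBsFld_of_def22Iso` — **T44-L15b ⇐ {faithful reading, context isomorphisms induced
  by `Ψ` on Frobenius-trivial objects}**; `…_of_def22Iso'` — the same with the input split as print has it: `Ψ`
  induces `ctx₁ A'' ≅ ctx₂ (Ψ A'')`, and the contexts of isomorphic objects of `C₂` are isomorphic;
* `Thm44Hyp.thm44_mkOfConnectedTemperoid_of_def22Iso` / `…_of_hBinj_of_def22Iso` / `…_of_baseInj_of_def22Iso` —
  abc-iut-w5-d179's consolidated [EtTh] Thm 4.4 (i) ∧ (ii) ∧ (iii) ∧ (`N`-th roots) at the GENUINE connected base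
  `B^temp(Π^tp_X)⁰` (`thm44_mkOfConnectedTemperoid`, p431376; `thm44_mkOfConnectedTemperoid_of_hBinj`;
  `thm44_mkOfConnectedTemperoid_of_baseInj`, p436787) with the binder T44-L15b REPLACED by the faithful-reading inputs
  — residual there = {Rmk 3.7.2 ×2, `hBmon` ×2} resp. {`hBinj` ×2} resp. {`hBD` ×2} ∪ {`hNH₁`, `hNH₂` (the reading),
  `hIso` (the context isomorphisms)}.

## Census — the interface datum the tree lacks (for abc-iut-L2-t3's v-next / abc-iut-L1-t4; NOT built here)

To WRITE `NH := «[FrdII] Def 2.2 (ii)»` at `mkOfConnectedTemperoid X tf …` one needs, for every object `A` of the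
base-field-theoretic hull `C^{bs-fld}` (Def 3.6 (iv): «a `p`-adic Frobenioid in the sense of [FrdII], Example 1.1,
(ii)») over `D = B^temp(Π^tp_X)⁰`, its [FrdII] Def 2.2 (i) CONTEXT: the base-field functor
`D → E = B(G_K)` (`A^bs ↦ A_E`, the `G_K`-set `A^bs/Δ_X`), the group `Aut_E(A_E)` (`= Π^tp_X/(U_A·Δ_X)` for Galois
`A^bs = Π^tp_X/U_A` — NOT the setting's `Aut_D(A^bs) = Π^tp_X/U_A`, where `galoisSurj` lands),
`res : Aut_C(A) → Aut_E(A_E)`, a representative `outer : G_K ↠ Aut_E(A_E)` with open kernel, and the descended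
action of `Aut_E(A_E) ⊇ G_A` on `O^×(A)` ([FrdII] Thm 1.2 (ii) for the hull); no field of `BiKummerSetting` or of
`SemiGraphs.TemperedArithmeticGroup` carries these.  On the `Thm44Hyp` side the context isomorphism needs the
topological isomorphism `G_{K₁} ⥲ G_{K₂}` UNDER the `θ : Π^tp_{X₁} ⥲ Π^tp_{X₂}` of T44-L09 `HodotCompatible`
([AbsAnab] Lem 1.3.8: `θ(Δ₁) = Δ₂`; abc-iut-L4's F-0007 `PreservesGeom`), compatible with `Ψ` on automorphism
groups (the shape of T44-L09c one level down) — not a field of `Thm44Hyp`.  These are typing tasks (definitions),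
deliberately NOT done in this proof-only file (D-0067 (5): no new `Prop` fact, no smuggled `def`).

HONEST FRAMING: refereed pre-IUT material ([EtTh] §4 over [FrdI]/[FrdII]/[SemiAnbd]/[AbsAnab]); a REDUCTION of a
free interface slot's transport to the tree's [FrdII] theorem, the reading carried as explicit hypotheses; nothing
here bears on the disputed [IUTchIII] Cor. 3.12; typed ≠ proved.
-/

noncomputable section

namespace Literature.AnabelianGeometry.EtaleTheta

open CategoryTheory Opposite Literature.AlgebraicGeometry.Frobenioids Literature.AnabelianGeometry.SemiGraphs

namespace BiKummerSetting

universe u₀ v₀ u v w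

/-! ### T44-L15b at the faithful reading, over ANY two §4 settings -/

section General

variable {K : Type u₀} [Field K] {K' : Type u₀} [Field K'] {D₀ : Type u₀} [Category.{v₀} D₀]
  {V : FrdIMonoidStub.{w}}
  {X₁ : SemiGraphs.TemperedArithmeticGroup.{u₀} K} {X₂ : SemiGraphs.TemperedArithmeticGroup.{u₀} K'}
  {D₀' : Type u₀} [Category.{v₀} D₀']
  {T₁ : RealifiedDivisorMonoids (D₀ := D₀) V} {T₂ : RealifiedDivisorMonoids (D₀ := D₀') V}
  {D₁ D₂ : Type u} [Category.{v} D₁] [Category.{v} D₂] {VD₁ : FrdICatStub.{u, v, w} D₁}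
  {VD₂ : FrdICatStub.{u, v, w} D₂} {S₁ : BiKummerSetting X₁ T₁ D₁ VD₁} {S₂ : BiKummerSetting X₂ T₂ D₂ VD₂}

/-- **The «manifestly category-theoretic nature» of `(N, H^{bs-fld}_⊙)`-saturation, at the faithful reading**
(p.95 ll.14–16; [FrdII] Thm 2.4 (i)): if the two settings' `(N, H_⊙^{bs-fld})`-saturation slots READ [FrdII]
Def 2.2 (ii) through Def 2.2 contexts `ctx₁ A''`, `ctx₂ B''` (`hNH₁`, `hNH₂`), then an isomorphism of those
contexts (what `Ψ` induces) identifies the two saturation conditions — abc-iut-L1-d4's `Def22Context.Iso.isNHSaturated_iff`.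
[cite: MochizukiEtTh2009, Thm 4.4 (iii) p.95] -/
theorem isNHSaturatedBsFld_iff_of_def22Iso
    (ctx₁ : S₁.C → PadicKummer.Def22Context) (ctx₂ : S₂.C → PadicKummer.Def22Context)
    (hNH₁ : ∀ (A : S₁.C) (N : ℕ+),
      S₁.IsNHSaturatedBsFld S₁.HodotBsFld A N ↔ PadicKummer.IsNHSaturated (ctx₁ A) N)
    (hNH₂ : ∀ (B : S₂.C) (N : ℕ+),
      S₂.IsNHSaturatedBsFld S₂.HodotBsFld B N ↔ PadicKummer.IsNHSaturated (ctx₂ B) N)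
    {A'' : S₁.C} {B'' : S₂.C} (ι : PadicKummer.Def22Context.Iso (ctx₁ A'') (ctx₂ B'')) (N : ℕ+) :
    S₁.IsNHSaturatedBsFld S₁.HodotBsFld A'' N ↔ S₂.IsNHSaturatedBsFld S₂.HodotBsFld B'' N := by
  rw [hNH₁, hNH₂]
  exact ι.isNHSaturated_iff N

/-- **T44-L15b `Thm44Hyp.PreservesNHSaturatedBsFld` AT THE FAITHFUL [FrdII] Def 2.2 (ii) READING ⇐ the context
isomorphisms induced by `Ψ`** (p.95 ll.14–16 «cf. [FrdII], Definition 2.2, (ii); [AbsAnab], Lemma 1.3.8»): for two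
§4 settings whose slots read [FrdII] Def 2.2 (ii) at `H^{bs-fld}_{⊙,i}` through context assignments `ctx_i`
(`hNH_i`), if `Ψ` induces, for every Frobenius-trivial `A''` and every `B'' ≅ Ψ(A'')`, an isomorphism of the
Def 2.2 contexts `ctx₁ A'' ⥲ ctx₂ B''` ([FrdI] Thm 3.4 (v) on `Aut`/`O^×`, [SemiAnbd] Prop 3.2 and [AbsAnab]
Lem 1.3.8 on `Π^tp_{X_i} ↠ G_{K_i} ⊇ H^{bs-fld}_{⊙,i}` — the INPUT `hIso`), then `Ψ` preserves and reflects
`(N, H^{bs-fld}_{⊙,i})`-saturation — the transport itself being abc-iut-L1-d4's theorem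
`Def22Context.Iso.isNHSaturated_iff` ([FrdII] Thm 2.4 (i)). [cite: MochizukiEtTh2009, Thm 4.4 (iii) p.95] -/
theorem Thm44Hyp.preservesNHSaturatedBsFld_of_def22Iso (h : Thm44Hyp S₁ S₂)
    (ctx₁ : S₁.C → PadicKummer.Def22Context) (ctx₂ : S₂.C → PadicKummer.Def22Context)
    (hNH₁ : ∀ (A : S₁.C) (N : ℕ+),
      S₁.IsNHSaturatedBsFld S₁.HodotBsFld A N ↔ PadicKummer.IsNHSaturated (ctx₁ A) N)
    (hNH₂ : ∀ (B : S₂.C) (N : ℕ+),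
      S₂.IsNHSaturatedBsFld S₂.HodotBsFld B N ↔ PadicKummer.IsNHSaturated (ctx₂ B) N)
    (hIso : ∀ (A'' : S₁.C) (B'' : S₂.C), S₁.IsFrobeniusTrivial A'' → (h.Ψ.functor.obj A'' ≅ B'') →
      Nonempty (PadicKummer.Def22Context.Iso (ctx₁ A'') (ctx₂ B''))) :
    h.PreservesNHSaturatedBsFld := by
  intro A'' B'' N hft hisom
  obtain ⟨e⟩ := hisom
  obtain ⟨ι⟩ := hIso A'' B'' hft e
  exact isNHSaturatedBsFld_iff_of_def22Iso ctx₁ ctx₂ hNH₁ hNH₂ ι N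

/-- **T44-L15b at the faithful reading, the input split as in print**: `Ψ` induces an isomorphism of the Def 2.2
contexts of a Frobenius-trivial `A''` and of `Ψ(A'')` (`hΨ` — [FrdI] Thm 3.4 (v) / [SemiAnbd] Prop 3.2 / [AbsAnab]
Lem 1.3.8), and the Def 2.2 context of an object of `C₂^{bs-fld}` depends on the object only up to isomorphism
(`hIso₂` — an isomorphism `B ≅ B'` of `C₂` induces a context isomorphism, [FrdII] Thm 2.4 (i) at `Ψ = 𝟭` moved
along `B ≅ B'`); composed by `Def22Context.Iso.trans`. [cite: MochizukiEtTh2009, Thm 4.4 (iii) p.95] -/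
theorem Thm44Hyp.preservesNHSaturatedBsFld_of_def22Iso' (h : Thm44Hyp S₁ S₂)
    (ctx₁ : S₁.C → PadicKummer.Def22Context) (ctx₂ : S₂.C → PadicKummer.Def22Context)
    (hNH₁ : ∀ (A : S₁.C) (N : ℕ+),
      S₁.IsNHSaturatedBsFld S₁.HodotBsFld A N ↔ PadicKummer.IsNHSaturated (ctx₁ A) N)
    (hNH₂ : ∀ (B : S₂.C) (N : ℕ+),
      S₂.IsNHSaturatedBsFld S₂.HodotBsFld B N ↔ PadicKummer.IsNHSaturated (ctx₂ B) N)
    (hΨ : ∀ A'' : S₁.C, S₁.IsFrobeniusTrivial A'' →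
      Nonempty (PadicKummer.Def22Context.Iso (ctx₁ A'') (ctx₂ (h.Ψ.functor.obj A''))))
    (hIso₂ : ∀ B B' : S₂.C, (B ≅ B') → Nonempty (PadicKummer.Def22Context.Iso (ctx₂ B) (ctx₂ B'))) :
    h.PreservesNHSaturatedBsFld :=
  h.preservesNHSaturatedBsFld_of_def22Iso ctx₁ ctx₂ hNH₁ hNH₂ fun A'' B'' hft e => by
    obtain ⟨ι₁⟩ := hΨ A'' hft
    obtain ⟨ι₂⟩ := hIso₂ _ B'' e
    exact ⟨ι₁.trans ι₂⟩

/-- **One direction suffices to state print's clause «`Ψ` maps `(N, H₁)`-saturated objects to `(N, H₂)`-saturated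
objects»** ([FrdII] Thm 2.4 (i)) at the faithful reading: the forward transport for one Frobenius-trivial `A''` and
one `B'' ≅ Ψ(A'')`. [cite: MochizukiEtTh2009, Thm 4.4 (iii) p.95] -/
theorem Thm44Hyp.isNHSaturatedBsFld_map_of_def22Iso (h : Thm44Hyp S₁ S₂)
    (ctx₁ : S₁.C → PadicKummer.Def22Context) (ctx₂ : S₂.C → PadicKummer.Def22Context)
    (hNH₁ : ∀ (A : S₁.C) (N : ℕ+),
      S₁.IsNHSaturatedBsFld S₁.HodotBsFld A N ↔ PadicKummer.IsNHSaturated (ctx₁ A) N)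
    (hNH₂ : ∀ (B : S₂.C) (N : ℕ+),
      S₂.IsNHSaturatedBsFld S₂.HodotBsFld B N ↔ PadicKummer.IsNHSaturated (ctx₂ B) N)
    {A'' : S₁.C} {B'' : S₂.C} (_e : h.Ψ.functor.obj A'' ≅ B'')
    (ι : PadicKummer.Def22Context.Iso (ctx₁ A'') (ctx₂ B'')) (N : ℕ+)
    (hA : S₁.IsNHSaturatedBsFld S₁.HodotBsFld A'' N) : S₂.IsNHSaturatedBsFld S₂.HodotBsFld B'' N :=
  (isNHSaturatedBsFld_iff_of_def22Iso ctx₁ ctx₂ hNH₁ hNH₂ ι N).1 hA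

end General

/-! ### At the genuine connected base `B^temp(Π^tp_X)⁰`: Thm 4.4 with T44-L15b replaced by its faithful inputs -/

section Connected

variable {K : Type u₀} [Field K] {K' : Type u₀} [Field K'] {X₁ : SemiGraphs.TemperedArithmeticGroup.{u₀} K}
  {X₂ : SemiGraphs.TemperedArithmeticGroup.{u₀} K'} {D₀ : Type u₀} [Category.{v₀} D₀] {D₀' : Type u₀}
  [Category.{v₀} D₀'] {T₁ : RealifiedDivisorMonoids (D₀ := D₀) treeMonoidVocab.{w}}
  {T₂ : RealifiedDivisorMonoids (D₀ := D₀') treeMonoidVocab.{w}}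
  {IsRational₁ IsStrictlyRational₁ : ((ConnectedPart (BTemp X₁.Pi))ᵒᵖ ⥤ CommMonCat.{w}) → Prop}
  {IsRational₂ IsStrictlyRational₂ : ((ConnectedPart (BTemp X₂.Pi))ᵒᵖ ⥤ CommMonCat.{w}) → Prop}
  {tf₁ : TemperedFrobenioid T₁ (ConnectedPart (BTemp X₁.Pi))
    (treeCatVocab (ConnectedPart (BTemp X₁.Pi)) IsRational₁ IsStrictlyRational₁)}
  {hZ₁ : tf₁.monoidType = MonoidType.Z} {hP₁ : ∀ A : (ConnectedPart (BTemp X₁.Pi))ᵒᵖ, IsPerfect (tf₁.Φ.carrier A)}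
  {NH₁ : Subgroup (Field.absoluteGaloisGroup K) → tf₁.category → ℕ+ → Prop} {A₁ : tf₁.category}
  {hA₁ : PreFrobenioid.IsFrobeniusTrivial tf₁.toElem A₁} {hA₁' : SemiGraphs.IsGaloisObj A₁.base.obj}
  {tf₂ : TemperedFrobenioid T₂ (ConnectedPart (BTemp X₂.Pi))
    (treeCatVocab (ConnectedPart (BTemp X₂.Pi)) IsRational₂ IsStrictlyRational₂)}
  {hZ₂ : tf₂.monoidType = MonoidType.Z} {hP₂ : ∀ B : (ConnectedPart (BTemp X₂.Pi))ᵒᵖ, IsPerfect (tf₂.Φ.carrier B)}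
  {NH₂ : Subgroup (Field.absoluteGaloisGroup K') → tf₂.category → ℕ+ → Prop} {A₂ : tf₂.category}
  {hA₂ : PreFrobenioid.IsFrobeniusTrivial tf₂.toElem A₂} {hA₂' : SemiGraphs.IsGaloisObj A₂.base.obj}

/-- **T44-L15b at the genuine connected base, faithful reading**: for abc-iut-L2-t4's settings
`mkOfConnectedTemperoid` whose free slots `NH₁`, `NH₂` READ [FrdII] Def 2.2 (ii) at `H^{bs-fld}_{⊙,i}` through
context assignments (`hNH₁`, `hNH₂`), T44-L15b ⇐ the context isomorphisms induced by `Ψ` (`hIso`).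
[cite: MochizukiEtTh2009, Thm 4.4 (iii) p.95] -/
theorem Thm44Hyp.preservesNHSaturatedBsFld_mkOfConnectedTemperoid_of_def22Iso
    (h : Thm44Hyp (mkOfConnectedTemperoid X₁ tf₁ hZ₁ hP₁ NH₁ A₁ hA₁ hA₁')
      (mkOfConnectedTemperoid X₂ tf₂ hZ₂ hP₂ NH₂ A₂ hA₂ hA₂'))
    (ctx₁ : tf₁.category → PadicKummer.Def22Context) (ctx₂ : tf₂.category → PadicKummer.Def22Context)
    (hNH₁ : ∀ (A : tf₁.category) (N : ℕ+),
      NH₁ (mkOfConnectedTemperoid X₁ tf₁ hZ₁ hP₁ NH₁ A₁ hA₁ hA₁').HodotBsFld A N ↔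
        PadicKummer.IsNHSaturated (ctx₁ A) N)
    (hNH₂ : ∀ (B : tf₂.category) (N : ℕ+),
      NH₂ (mkOfConnectedTemperoid X₂ tf₂ hZ₂ hP₂ NH₂ A₂ hA₂ hA₂').HodotBsFld B N ↔
        PadicKummer.IsNHSaturated (ctx₂ B) N)
    (hIso : ∀ (A'' : tf₁.category) (B'' : tf₂.category), PreFrobenioid.IsFrobeniusTrivial tf₁.toElem A'' →
      (h.Ψ.functor.obj A'' ≅ B'') → Nonempty (PadicKummer.Def22Context.Iso (ctx₁ A'') (ctx₂ B''))) :
    h.PreservesNHSaturatedBsFld :=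
  h.preservesNHSaturatedBsFld_of_def22Iso ctx₁ ctx₂ hNH₁ hNH₂ hIso

/-- **[EtTh] Thm 4.4 (i) ∧ (ii) ∧ (iii) ∧ (`N`-th roots) at the GENUINE connected base with T44-L15b AT THE FAITHFUL
READING** — abc-iut-w5-d179's `thm44_mkOfConnectedTemperoid` (p431376) with its binder `h15` replaced by the faithful
inputs: residual = {Rmk 3.7.2 (`Remark372 D₀ / D₀'`), `hBmon₁ / hBmon₂`} ∪ {the [FrdII] Def 2.2 (ii) reading of the
slots (`hNH₁`, `hNH₂`), the context isomorphisms induced by `Ψ` (`hIso`: [FrdI] Thm 3.4 (v), [SemiAnbd] Prop 3.2,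
[AbsAnab] Lem 1.3.8)}. [cite: MochizukiEtTh2009, Thm 4.4 p.94] -/
theorem Thm44Hyp.thm44_mkOfConnectedTemperoid_of_def22Iso
    (h : Thm44Hyp (mkOfConnectedTemperoid X₁ tf₁ hZ₁ hP₁ NH₁ A₁ hA₁ hA₁')
      (mkOfConnectedTemperoid X₂ tf₂ hZ₂ hP₂ NH₂ A₂ hA₂ hA₂'))
    (h372 : TemperedFrobenioid.Remark372 D₀) (h372' : TemperedFrobenioid.Remark372 D₀')
    (hBmon₁ : IsMonoidOn tf₁.ratFnFunctor) (hBmon₂ : IsMonoidOn tf₂.ratFnFunctor)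
    (ctx₁ : tf₁.category → PadicKummer.Def22Context) (ctx₂ : tf₂.category → PadicKummer.Def22Context)
    (hNH₁ : ∀ (A : tf₁.category) (N : ℕ+),
      NH₁ (mkOfConnectedTemperoid X₁ tf₁ hZ₁ hP₁ NH₁ A₁ hA₁ hA₁').HodotBsFld A N ↔
        PadicKummer.IsNHSaturated (ctx₁ A) N)
    (hNH₂ : ∀ (B : tf₂.category) (N : ℕ+),
      NH₂ (mkOfConnectedTemperoid X₂ tf₂ hZ₂ hP₂ NH₂ A₂ hA₂ hA₂').HodotBsFld B N ↔
        PadicKummer.IsNHSaturated (ctx₂ B) N)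
    (hIso : ∀ (A'' : tf₁.category) (B'' : tf₂.category), PreFrobenioid.IsFrobeniusTrivial tf₁.toElem A'' →
      (h.Ψ.functor.obj A'' ≅ B'') → Nonempty (PadicKummer.Def22Context.Iso (ctx₁ A'') (ctx₂ B''))) :
    Thm44_i h ∧
      Thm44_ii h (h.psiModel (tf₁.isFrobenioid_treeCatVocab_of_isMonoidOn hBmon₁)
        (tf₂.isFrobenioid_treeCatVocab_of_isMonoidOn hBmon₂)
        (h.preservesFrobeniusStructure_treeVocab h372 h372' hBmon₁ hBmon₂)) ∧
      Thm44_iii h (h.psiModel (tf₁.isFrobenioid_treeCatVocab_of_isMonoidOn hBmon₁)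
        (tf₂.isFrobenioid_treeCatVocab_of_isMonoidOn hBmon₂)
        (h.preservesFrobeniusStructure_treeVocab h372 h372' hBmon₁ hBmon₂)) ∧
      h.PreservesNthRoots (h.psiModel (tf₁.isFrobenioid_treeCatVocab_of_isMonoidOn hBmon₁)
        (tf₂.isFrobenioid_treeCatVocab_of_isMonoidOn hBmon₂)
        (h.preservesFrobeniusStructure_treeVocab h372 h372' hBmon₁ hBmon₂))
        (fun φ f => tf₁.pullFracModel φ f) (fun φ f => tf₂.pullFracModel φ f) :=
  h.thm44_mkOfConnectedTemperoid h372 h372' hBmon₁ hBmon₂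
    (h.preservesNHSaturatedBsFld_mkOfConnectedTemperoid_of_def22Iso ctx₁ ctx₂ hNH₁ hNH₂ hIso)

/-- **The same over abc-iut-w5-d179's `hBinj` consolidation** (`thm44_mkOfConnectedTemperoid_of_hBinj`): [EtTh]
Thm 4.4 (i) ∧ (ii) ∧ (iii) ∧ (`N`-th roots) at the genuine connected base ⇐ {«`C_i` Frobenioid», T44-L03, `hBinj₁ /
hBinj₂`} ∪ {faithful reading `hNH₁` / `hNH₂`, context isomorphisms `hIso`} — the binder T44-L15b no longer
appears. [cite: MochizukiEtTh2009, Thm 4.4 p.94] -/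
theorem Thm44Hyp.thm44_mkOfConnectedTemperoid_of_hBinj_of_def22Iso
    (h : Thm44Hyp (mkOfConnectedTemperoid X₁ tf₁ hZ₁ hP₁ NH₁ A₁ hA₁ hA₁')
      (mkOfConnectedTemperoid X₂ tf₂ hZ₂ hP₂ NH₂ A₂ hA₂ hA₂'))
    (hF₁ : PreFrobenioid.IsFrobenioid tf₁.toElem) (hF₂ : PreFrobenioid.IsFrobenioid tf₂.toElem)
    (h3 : h.PreservesFrobeniusStructure)
    (hBinj₁ : ∀ {Y Y' : D₀ᵒᵖ} (g : Y ⟶ Y'), Function.Injective (T₁.BΛ.map g).hom)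
    (hBinj₂ : ∀ {Y Y' : D₀'ᵒᵖ} (g : Y ⟶ Y'), Function.Injective (T₂.BΛ.map g).hom)
    (ctx₁ : tf₁.category → PadicKummer.Def22Context) (ctx₂ : tf₂.category → PadicKummer.Def22Context)
    (hNH₁ : ∀ (A : tf₁.category) (N : ℕ+),
      NH₁ (mkOfConnectedTemperoid X₁ tf₁ hZ₁ hP₁ NH₁ A₁ hA₁ hA₁').HodotBsFld A N ↔
        PadicKummer.IsNHSaturated (ctx₁ A) N)
    (hNH₂ : ∀ (B : tf₂.category) (N : ℕ+),
      NH₂ (mkOfConnectedTemperoid X₂ tf₂ hZ₂ hP₂ NH₂ A₂ hA₂ hA₂').HodotBsFld B N ↔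
        PadicKummer.IsNHSaturated (ctx₂ B) N)
    (hIso : ∀ (A'' : tf₁.category) (B'' : tf₂.category), PreFrobenioid.IsFrobeniusTrivial tf₁.toElem A'' →
      (h.Ψ.functor.obj A'' ≅ B'') → Nonempty (PadicKummer.Def22Context.Iso (ctx₁ A'') (ctx₂ B''))) :
    Thm44_i h ∧ Thm44_ii h (h.psiModel hF₁ hF₂ h3) ∧ Thm44_iii h (h.psiModel hF₁ hF₂ h3) ∧
      h.PreservesNthRoots (h.psiModel hF₁ hF₂ h3) (fun φ f => tf₁.pullFracModel φ f)
        (fun φ f => tf₂.pullFracModel φ f) :=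
  h.thm44_mkOfConnectedTemperoid_of_hBinj hF₁ hF₂ h3 hBinj₁ hBinj₂
    (h.preservesNHSaturatedBsFld_mkOfConnectedTemperoid_of_def22Iso ctx₁ ctx₂ hNH₁ hNH₂ hIso)

/-- **The same over abc-iut-w5-d179's BASE-IMAGE consolidation** (`thm44_mkOfConnectedTemperoid_of_baseInj`, p436787 —
the print-faithful form of the Def 3.6 (i) injectivity binder: `B₀^Λ` pull-backs injective along the coverings
`Base(α)`, `α` in `D = B^temp(Π^tp_X)⁰`): [EtTh] Thm 4.4 (i) ∧ (ii) ∧ (iii) ∧ (`N`-th roots) at the genuine connected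
base ⇐ {«`C_i` Frobenioid», T44-L03, `hBD₁ / hBD₂`} ∪ {faithful reading `hNH₁` / `hNH₂`, context isomorphisms
`hIso`}. [cite: MochizukiEtTh2009, Thm 4.4 p.94] -/
theorem Thm44Hyp.thm44_mkOfConnectedTemperoid_of_baseInj_of_def22Iso
    (h : Thm44Hyp (mkOfConnectedTemperoid X₁ tf₁ hZ₁ hP₁ NH₁ A₁ hA₁ hA₁')
      (mkOfConnectedTemperoid X₂ tf₂ hZ₂ hP₂ NH₂ A₂ hA₂ hA₂'))
    (hF₁ : PreFrobenioid.IsFrobenioid tf₁.toElem) (hF₂ : PreFrobenioid.IsFrobenioid tf₂.toElem)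
    (h3 : h.PreservesFrobeniusStructure)
    (hBD₁ : ∀ {A B : ConnectedPart (BTemp X₁.Pi)} (α : B ⟶ A),
      Function.Injective (T₁.BΛ.map (tf₁.base.map α).op).hom)
    (hBD₂ : ∀ {A B : ConnectedPart (BTemp X₂.Pi)} (α : B ⟶ A),
      Function.Injective (T₂.BΛ.map (tf₂.base.map α).op).hom)
    (ctx₁ : tf₁.category → PadicKummer.Def22Context) (ctx₂ : tf₂.category → PadicKummer.Def22Context)
    (hNH₁ : ∀ (A : tf₁.category) (N : ℕ+),
      NH₁ (mkOfConnectedTemperoid X₁ tf₁ hZ₁ hP₁ NH₁ A₁ hA₁ hA₁').HodotBsFld A N ↔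
        PadicKummer.IsNHSaturated (ctx₁ A) N)
    (hNH₂ : ∀ (B : tf₂.category) (N : ℕ+),
      NH₂ (mkOfConnectedTemperoid X₂ tf₂ hZ₂ hP₂ NH₂ A₂ hA₂ hA₂').HodotBsFld B N ↔
        PadicKummer.IsNHSaturated (ctx₂ B) N)
    (hIso : ∀ (A'' : tf₁.category) (B'' : tf₂.category), PreFrobenioid.IsFrobeniusTrivial tf₁.toElem A'' →
      (h.Ψ.functor.obj A'' ≅ B'') → Nonempty (PadicKummer.Def22Context.Iso (ctx₁ A'') (ctx₂ B''))) :
    Thm44_i h ∧ Thm44_ii h (h.psiModel hF₁ hF₂ h3) ∧ Thm44_iii h (h.psiModel hF₁ hF₂ h3) ∧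
      h.PreservesNthRoots (h.psiModel hF₁ hF₂ h3) (fun φ f => tf₁.pullFracModel φ f)
        (fun φ f => tf₂.pullFracModel φ f) :=
  h.thm44_mkOfConnectedTemperoid_of_baseInj _ _ _ _ _ _ _ _ _ _ _ _ _ _ hF₁ hF₂ h3 hBD₁ hBD₂
    (h.preservesNHSaturatedBsFld_mkOfConnectedTemperoid_of_def22Iso ctx₁ ctx₂ hNH₁ hNH₂ hIso)

end Connected

end BiKummerSetting

end Literature.AnabelianGeometry.EtaleTheta

end

/-! ## v2 (append-only): the Galois-side Def 2.2 data AT THE GENUINE CONNECTED BASE, T44-L09 discharged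

With file 2 (`BiKummerThm44SubGaloisDescent.lean`, abc-iut-w6-d047) and abc-iut-w5-d013's UNCONDITIONAL T44-L09
`Thm44Hyp.hodotCompatible_mkOfConnectedTemperoid` ([SemiAnbd] Prop 3.2 over `B^temp(Π^tp_X)⁰`): for the settings
`mkOfConnectedTemperoid`, the `G`/`H`-fields of the [FrdII] Def 2.2 context isomorphism that `hIso` above asks for —
`isoG : G_{K₁} ⥲ G_{K₂}` (topological), `map_H : isoG(H^{bs-fld}_{⊙,1}) = H^{bs-fld}_{⊙,2}`, `[H.Normal]`, `isOpen_H`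
— follow from [AbsAnab] Lem 1.3.8 in its printed ∀-form for the two tempered groups («an isomorphism
`Π₁ ⥲ Π₂` carries `Δ₁` onto `Δ₂`», hypothesis `hΔ`, the tree's F-0007 shape) and open augmentations (`haug₁`, `haug₂`).
-/

namespace Literature.AnabelianGeometry.EtaleTheta

open CategoryTheory Opposite Literature.AlgebraicGeometry.Frobenioids Literature.AnabelianGeometry.SemiGraphs

namespace BiKummerSetting

universe u₀' v₀' w'

section ConnectedGalois

variable {K : Type u₀'} [Field K] {K' : Type u₀'} [Field K'] {X₁ : SemiGraphs.TemperedArithmeticGroup.{u₀'} K}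
  {X₂ : SemiGraphs.TemperedArithmeticGroup.{u₀'} K'} {D₀ : Type u₀'} [Category.{v₀'} D₀] {D₀' : Type u₀'}
  [Category.{v₀'} D₀'] {V : FrdIMonoidStub.{w'}} {T₁ : RealifiedDivisorMonoids (D₀ := D₀) V}
  {T₂ : RealifiedDivisorMonoids (D₀ := D₀') V}
  {VD₁ : FrdICatStub.{u₀' + 1, u₀', w'} (ConnectedPart (BTemp X₁.Pi))}
  {VD₂ : FrdICatStub.{u₀' + 1, u₀', w'} (ConnectedPart (BTemp X₂.Pi))}
  {tf₁ : TemperedFrobenioid T₁ (ConnectedPart (BTemp X₁.Pi)) VD₁} {hZ₁ : tf₁.monoidType = MonoidType.Z}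
  {hP₁ : ∀ A : (ConnectedPart (BTemp X₁.Pi))ᵒᵖ, IsPerfect (tf₁.Φ.carrier A)}
  {NH₁ : Subgroup (Field.absoluteGaloisGroup K) → tf₁.category → ℕ+ → Prop} {A₁ : tf₁.category}
  {hA₁ : PreFrobenioid.IsFrobeniusTrivial tf₁.toElem A₁} {hA₁' : SemiGraphs.IsGaloisObj A₁.base.obj}
  {tf₂ : TemperedFrobenioid T₂ (ConnectedPart (BTemp X₂.Pi)) VD₂} {hZ₂ : tf₂.monoidType = MonoidType.Z}
  {hP₂ : ∀ B : (ConnectedPart (BTemp X₂.Pi))ᵒᵖ, IsPerfect (tf₂.Φ.carrier B)}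
  {NH₂ : Subgroup (Field.absoluteGaloisGroup K') → tf₂.category → ℕ+ → Prop} {A₂ : tf₂.category}
  {hA₂ : PreFrobenioid.IsFrobeniusTrivial tf₂.toElem A₂} {hA₂' : SemiGraphs.IsGaloisObj A₂.base.obj}

/-- **The Galois-side [FrdII] Def 2.2 data at the genuine connected base `B^temp(Π^tp_X)⁰`, T44-L09 DISCHARGED**:
for abc-iut-L2-t4's settings `mkOfConnectedTemperoid` (ANY `FrdICatStub` vocabulary) and any `h : Thm44Hyp`, if every
isomorphism `Π^tp_{X₁} ⥲ Π^tp_{X₂}` carries `Δ₁` onto `Δ₂` ([AbsAnab] Lem 1.3.8, hypothesis `hΔ`) and the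
augmentations are open maps, then `H^{bs-fld}_{⊙,i} ⊆ G_{K_i}` are normal open subgroups and `Ψ^bs`'s isomorphism
(abc-iut-w5-d013's `hodotCompatible_mkOfConnectedTemperoid`, [SemiAnbd] Prop 3.2) descends to a topological
`ι : G_{K₁} ⥲ G_{K₂}` with `ι(H^{bs-fld}_{⊙,1}) = H^{bs-fld}_{⊙,2}` — the `isoG`/`map_H`/`[H.Normal]`/`isOpen_H` fields
of the context isomorphism in `hIso`; residual of those fields = {`hΔ` (F-0007 shape), `haug₁`, `haug₂`} only.
[cite: MochizukiEtTh2009, Thm 4.4 p.95] -/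
theorem Thm44Hyp.hodotBsFld_def22Data_mkOfConnectedTemperoid
    (h : Thm44Hyp (mkOfConnectedTemperoid X₁ tf₁ hZ₁ hP₁ NH₁ A₁ hA₁ hA₁')
      (mkOfConnectedTemperoid X₂ tf₂ hZ₂ hP₂ NH₂ A₂ hA₂ hA₂'))
    (hΔ : ∀ θ : X₁.Pi ≃ₜ* X₂.Pi, X₁.delta.map θ.toMulEquiv.toMonoidHom = X₂.delta)
    (haug₁ : IsOpenMap X₁.aug) (haug₂ : IsOpenMap X₂.aug) :
    (mkOfConnectedTemperoid X₁ tf₁ hZ₁ hP₁ NH₁ A₁ hA₁ hA₁').HodotBsFld.Normal ∧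
      (mkOfConnectedTemperoid X₂ tf₂ hZ₂ hP₂ NH₂ A₂ hA₂ hA₂').HodotBsFld.Normal ∧
      IsOpen ((mkOfConnectedTemperoid X₁ tf₁ hZ₁ hP₁ NH₁ A₁ hA₁ hA₁').HodotBsFld :
        Set (Field.absoluteGaloisGroup K)) ∧
      IsOpen ((mkOfConnectedTemperoid X₂ tf₂ hZ₂ hP₂ NH₂ A₂ hA₂ hA₂').HodotBsFld :
        Set (Field.absoluteGaloisGroup K')) ∧
      ∃ ι : Field.absoluteGaloisGroup K ≃ₜ* Field.absoluteGaloisGroup K',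
        (mkOfConnectedTemperoid X₁ tf₁ hZ₁ hP₁ NH₁ A₁ hA₁ hA₁').HodotBsFld.map ι.toMulEquiv.toMonoidHom =
          (mkOfConnectedTemperoid X₂ tf₂ hZ₂ hP₂ NH₂ A₂ hA₂ hA₂').HodotBsFld := by
  obtain ⟨θ, hθ⟩ := h.hodotCompatible_mkOfConnectedTemperoid
  exact h.hodotBsFld_def22Data_of_hodotDeltaCompatible ⟨θ, hθ, hΔ θ⟩ haug₁ haug₂

end ConnectedGalois

end BiKummerSetting

end Literature.AnabelianGeometry.EtaleTheta
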